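import Summits.ResolutionOfSingularities.ResolutionOfSingularities.Theorems.FrobeniusClosingSteerToricUnitExitDeriv

/-!
# Crux `Steer` (stmt-ResolutionOfSingularities-16345) — K-TX part 4, the END ARGUMENT of case B with an EULER derivation:
# `D₀·(S²·(w·Y^s) − Γ²) ∉ (ker φ)²` as soon as the log-pairing `Σ_v s_v c_v` of the monomial `Y^s` with some weight `c` is non-zero

[cite: CossartPiltant2008, §4]; folklore commutative algebra.

The STALE-unit case of the toric unit exit (design: seat folder `D/res-D-brk-2/HANDOFF.md`, gen 6, "RECOMMENDED ROUTE for K-TX part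
4d") transports the radicand `u·W − h²` by a residue-compatible ring map `Φ : R' → κ(O)[Y_σ]_𝔭` (`𝔭 = ker` of the evaluation at the
residues); the survivor unit letter `u` goes to a Laurent monomial whose exponent row `k_u` is a member of a family with a DUAL family of
weights `c_u : σ → κ(O)` (`⟨c_u, k_{u'}⟩ = δ`), maintained along the tower by elementary row/dual-row operations.  The end argument is then
`sq_free_euler` below with the Euler derivation `∂_c = Σ_v c_v·Y_v·∂/∂Y_v`, whose value on a monomial `Y^s` is `⟨c, s⟩·Y^s`
(`euler_monomial`), so `∂_c (Y^s) ∉ 𝔭` iff `⟨c, s⟩ ≠ 0` (the variables being outside `𝔭`).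

Contents (namespace `…Theorems.SteerToricUnitExit`):
* `euler_X`, `euler_monomial` — the Euler derivation `MvPolynomial.mkDerivation κ (fun v => C (c v) * X v)` on variables and monomials;
* `map_monomial_ne_zero`, `monomial_not_mem_ker` — a monomial in variables not killed by `φ` is not in `ker φ`;
* `sq_free_euler` — the packaged end argument.
-/

-- single-problem summit: the doubled namespace component `ResolutionOfSingularities` is forced
set_option linter.dupNamespace false

open scoped BigOperators

noncomputable section

namespace Summit.ResolutionOfSingularities.ResolutionOfSingularities.Theorems.SteerToricUnitExit

open MvPolynomial

variable {σ κ : Type*} [Field κ]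

/-- The Euler derivation with weights `c` sends `Y_v` to `c_v·Y_v`. [folklore] -/
theorem euler_X (c : σ → κ) (v : σ) :
    mkDerivation κ (fun v => C (c v) * X v) (X v : MvPolynomial σ κ) = C (c v) * X v :=
  mkDerivation_X _ _ _

/-- The Euler derivation with weights `c` sends the monomial `a·Y^s` to `⟨c, s⟩·a·Y^s`, `⟨c, s⟩ = Σ_v s_v c_v`. [folklore] -/
theorem euler_monomial (c : σ → κ) (s : σ →₀ ℕ) (a : κ) :
    mkDerivation κ (fun v => C (c v) * X v) (monomial s a) =
      C (s.sum fun v n => (n : κ) * c v) * monomial s a := by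
  classical
  induction s using Finsupp.induction with
  | zero => simp
  | single_add v n f hv hn ih =>
    -- `Y^(single v n + f) = Y_v^n · Y^f`
    have hsplit : (monomial (Finsupp.single v n + f) a : MvPolynomial σ κ) = X v ^ n * monomial f a := by
      rw [X_pow_eq_monomial, monomial_mul, one_mul]
    rw [hsplit, Derivation.leibniz, Derivation.leibniz_pow, euler_X, ih, smul_eq_mul, smul_eq_mul,
      Finsupp.sum_add_index' (fun _ => by simp) (fun _ _ _ => by push_cast; ring),
      Finsupp.sum_single_index (by simp)]
    rcases Nat.eq_zero_or_pos n with h | h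
    · exact absurd h hn
    · obtain ⟨m, rfl⟩ := Nat.exists_eq_add_of_le h
      simp only [Nat.add_sub_cancel_left, map_add, map_mul, map_natCast, nsmul_eq_mul]
      push_cast
      ring

/-- A ring map not killing the variables of `s` does not kill the monomial `Y^s`. [folklore] -/
theorem map_monomial_ne_zero {F : Type*} [Field F] (φ : MvPolynomial σ κ →+* F) (s : σ →₀ ℕ)
    (hs : ∀ v ∈ s.support, φ (X v) ≠ 0) : φ (monomial s 1) ≠ 0 := by
  classical
  rw [monomial_eq, map_mul, C_1, map_one, one_mul, Finsupp.prod, map_prod]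
  exact Finset.prod_ne_zero_iff.mpr fun v hv => by rw [map_pow]; exact pow_ne_zero _ (hs v hv)

/-- Hence such a monomial is not in `ker φ`. [folklore] -/
theorem monomial_not_mem_ker {F : Type*} [Field F] (φ : MvPolynomial σ κ →+* F) (s : σ →₀ ℕ)
    (hs : ∀ v ∈ s.support, φ (X v) ≠ 0) : (monomial s 1 : MvPolynomial σ κ) ∉ RingHom.ker φ := by
  rw [RingHom.mem_ker]; exact map_monomial_ne_zero φ s hs

/-- **The end argument of case B, Euler form.** Over a field `κ` of characteristic `2`, let `φ : κ[Y_σ] → F` be a ring map to a field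
(`𝔭 = ker φ` is prime), `s` an exponent vector whose variables are not killed by `φ`, and `c` weights with non-zero log-pairing
`⟨c, s⟩ = Σ_v s_v c_v`.  Then for `D₀, S ∉ 𝔭` and a non-zero constant `w`: `D₀·(S²·(w·Y^s) − Γ²) ∉ 𝔭²`.
[cite: CossartPiltant2008, §4]; folklore. -/
theorem sq_free_euler (h2 : (2 : κ) = 0) {F : Type*} [Field F] (φ : MvPolynomial σ κ →+* F) (c : σ → κ) (s : σ →₀ ℕ)
    (hpair : (s.sum fun v n => (n : κ) * c v) ≠ 0) (hs : ∀ v ∈ s.support, φ (X v) ≠ 0)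
    (D₀ S Γ : MvPolynomial σ κ) (w : κ) (hw : w ≠ 0) (hD₀ : φ D₀ ≠ 0) (hS : φ S ≠ 0) :
    D₀ * (S ^ 2 * (C w * monomial s 1) - Γ ^ 2) ∉ RingHom.ker φ ^ 2 := by
  have h2' : (2 : MvPolynomial σ κ) = 0 := by rw [← map_ofNat (C : κ →+* MvPolynomial σ κ) 2, h2, map_zero]
  haveI : (RingHom.ker φ).IsPrime := RingHom.ker_isPrime φ
  refine sq_free_of_derivation h2' (mkDerivation κ (fun v => C (c v) * X v)) (RingHom.ker φ) D₀ S Γ (C w) _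
    (by rwa [RingHom.mem_ker]) (by rwa [RingHom.mem_ker]) ?_ (derivation_C _ _) ?_
  · rw [RingHom.mem_ker]
    intro h
    have : φ.comp C w = 0 := h
    exact (map_ne_zero (φ.comp C)).mpr hw this
  · rw [euler_monomial, RingHom.mem_ker, map_mul]
    refine mul_ne_zero ?_ (map_monomial_ne_zero φ s hs)
    intro h
    have : φ.comp C _ = 0 := h
    exact (map_ne_zero (φ.comp C)).mpr hpair this

end Summit.ResolutionOfSingularities.ResolutionOfSingularities.Theorems.SteerToricUnitExit

end
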